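import Summits.QuantumFields.BalabanUV.Beta.FP.KernelPeriodisationFibTraceTwo

/-!
# `BalabanUV.Beta.FP.KernelPeriodisationFibTraceTwoBound` — road «FP» (binder row D1), (T-PER) PART 4″ continued = (P2″) (ii) of the OWNER d1-p3 g21's
# WANTED W-FP-21-5 (a): **THE TWO-INSERTION WRAP-AROUND ESTIMATE** — `|trace (perF M (dper M (X ⋆ dper M V))) − tr (X ⋆ V)| ≤ C″·e^{−(ε∕4)·N}` for
# periods `M_i ≥ N` (`ε = min δ δ′`, `C″` explicit), and its `Tendsto` corollary along any box sequence with `∀ N, ∀ᶠ k, ∀ i, N ≤ M k i`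

WHAT.  §1 **`abs_trace_perF_dper_comp_dper_sub_tr_le`**: by `KernelPeriodisationFibTraceTwo.trace_perF_dper_comp_dper` the torus trace is `Σ'_j Σ'_m trSh M Z_j m`;
the `j = 0` copy is the lattice word `X ⋆ V` whose `m`-sum is PART 4's `trace (perF M (dper M (X ⋆ V)))`, within `e^{−(ε∕4)N}` of `tr (X ⋆ V)`
(`abs_trace_perF_dper_sub_tr_le` at the data of `biLoc_copy_zero`); the `j ≠ 0` copies are bounded by `abs_ite_tsum_trSh_copy_le` and summed with
`summable_copyConst` at rate `ε∕4`.  §2 **`tendsto_trace_perF_dper_comp_dper`**: for boxes `Mk : ℕ → (Fin (d+1) → ℕ)` with `∀ N, ∀ᶠ k, ∀ i, N ≤ Mk k i`,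
`trace (perF (Mk k) (dper (Mk k) (X ⋆ dper (Mk k) V))) → tr (X ⋆ V)` — the hypothesis shape of the OWNER's #23 `KernelLawDeperiodised.law_of_tendsto`.
§3 THE (T-ID) ASSEMBLY's WORDS through an `Mℤ`-invariant decaying leg `A` and bi-localised insertions `U V W`: the tadpole `perF A · perF (dper W) =
perF (dper (A ⋆ W))` (`perF_mul_perF_dper`) with **`abs_trace_tadpole_sub_tr_le`** (PART 4 in one call), and the bubble `perF A · perF (dper U) · perF A ·
perF (dper V) = perF (dper (((A ⋆ U) ⋆ A) ⋆ dper V))` (`perF_bubble_word`: `perF_comp` ×3 + `comp_dper_left ∕ _right`, no reassociation) with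
**`trace_bubble_eq_tsum`**, **`abs_trace_bubble_sub_tr_le`** (rate `e^{−(ε∕4)N}`, `ε = min (min α δU ∕ 4) δV`, constant displayed) and **`tendsto_trace_bubble`**.
NOT IN PRINT; OUR BOOKKEEPING ([folklore]).  No `def`, no `Prop` minted, nothing cited, 0 sorry.  Moves NO (CONV-C) clause and NO row-D1 binder; NOT SDF, NOT D1,
NOT BetaPertH, NOT continuum, NOT Clay.  HONEST DEPENDENCY: continuum YM on T⁴ ⇐ BetaPertH ∧ nine spine estimates (0/9 proved); BetaPertH ⇐ (D1) ∧ (D4) ∧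
CAP+tail; G-an2-4 gates asym, D1 and NE2/3/4.  D1 formalisation swarm LEAF PROVER 06 (b2b-balaban-beta-d1-formalise-leaf-06 gen 22), 2026-08-22.  No existing file touched.
-/

noncomputable section

open scoped BigOperators Matrix Topology
open Finset Filter

namespace Summit.QuantumFields.BalabanUV.Beta.FP.KernelPeriodisationFibTraceTwoBound

open Literature.MathematicalPhysics.QuantumFieldTheory.Balaban1983to89
open Literature.MathematicalPhysics.QuantumFieldTheory.Balaban1983to89.Beta
open B12Sec2to5 (l1 l1_nonneg)
open B4TorusKernel.MultiPeriod (translate)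
open B4Sect5Proof (latticeConst latticeConst_nonneg)
open ExpKernelCalculus (MKer Decays BiLoc tr shiftK Zl Zl_nonneg biLoc_comp_decays)
open OneStepResolventKernel (biLoc_mono decays_mono)
open BalabanStepJetsSucc (biLoc_comp_right)
open Summit.QuantumFields.BalabanUV.Beta.FP.KernelPeriodisationFib (perF perF_comp)
open Summit.QuantumFields.BalabanUV.Beta.FP.KernelPeriodisationFibLoc (dper dper_translate decays_dper comp_dper_left comp_dper_right)
open Summit.QuantumFields.BalabanUV.Beta.FP.KernelPeriodisationFibTrace (trSh trace_perF_dper abs_trace_perF_dper_sub_tr_le)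
open Summit.QuantumFields.BalabanUV.Beta.FP.KernelPeriodisationFibTraceRel (shiftK_Mmul_zero)
open Summit.QuantumFields.BalabanUV.Beta.FP.KernelPeriodisationFibTraceTwo (trace_perF_dper_comp_dper summable_tsum_trSh_copies abs_ite_tsum_trSh_copy_le
  biLoc_copy_zero summable_copyConst)

variable {d : ℕ} {F : Type*} [Fintype F]

/-! ## §1 The wrap-around estimate for the two-insertion word -/

section Bound

variable (M : Fin (d + 1) → ℕ) [∀ μ, NeZero (M μ)]
variable {X V : MKer (d + 1) F} {C C' δ δ' : ℝ} {p q p' q' : Fin (d + 1) → ℤ}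

/-- [folklore] **`abs_trace_perF_dper_comp_dper_sub_tr_le` — THE TWO-INSERTION WRAP-AROUND ESTIMATE**: for bi-localised `X` (`BiLoc X p q C δ`),
`V` (`BiLoc V p′ q′ C′ δ′`), `δ, δ′ > 0`, and periods `M_i ≥ N`:
`|trace (perF M (dper M (X ⋆ dper M V))) − tr (X ⋆ V)| ≤ |F|·B·(Zl(ε∕4)·K(ε∕4))·(e^{−(ε∕2)|q−p′|₁}·e^{(ε∕4)|p−q′|₁} + e^{(ε∕4)|q−p′|₁}·K(ε∕4))·e^{−(ε∕4)N}`,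
`ε = min δ δ′`, `B = |F|·C·C′·Zl(ε∕2)` — for FIXED lattice insertions the torus read-out tends to the lattice one as the torus grows. -/
theorem abs_trace_perF_dper_comp_dper_sub_tr_le (hX : BiLoc X p q C δ) (hV : BiLoc V p' q' C' δ') (hδ : 0 < δ) (hδ' : 0 < δ') {N : ℕ}
    (hMN : ∀ i, N ≤ M i) :
    |Matrix.trace (perF M (dper M (ExpKernelCalculus.comp X (dper M V)))) - tr (ExpKernelCalculus.comp X V)| ≤
      (Fintype.card F : ℝ) * ((Fintype.card F : ℝ) * (C * C') * Zl (d + 1) (min δ δ' / 2)) *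
        (Zl (d + 1) (min δ δ' / 2 / 2) * latticeConst (d + 1) (min δ δ' / 2 / 2)) *
        (Real.exp (-(min δ δ' / 2) * l1 (q - p')) * Real.exp (min δ δ' / 2 / 2 * l1 (p - q'))
          + Real.exp (min δ δ' / 4 * l1 (q - p')) * latticeConst (d + 1) (min δ δ' / 4)) * Real.exp (-(min δ δ' / 4 * N)) := by
  classical
  rcases isEmpty_or_nonempty F with hF | ⟨⟨a₀⟩⟩
  · have h0 : Matrix.trace (perF M (dper M (ExpKernelCalculus.comp X (dper M V)))) = 0 := by
      rw [KernelPeriodisationFibTrace.trace_perF]; simp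
    have h1 : tr (ExpKernelCalculus.comp X V) = 0 := by
      simp only [ExpKernelCalculus.tr, Finset.univ_eq_empty, Finset.sum_empty, tsum_zero]
    rw [h0, h1, sub_zero, abs_zero, Fintype.card_eq_zero, Nat.cast_zero]
    simp
  have hC : 0 ≤ C := hX.nonneg a₀
  have hC' : 0 ≤ C' := hV.nonneg a₀
  have hε0 : 0 < min δ δ' := lt_min hδ hδ'
  have hε : 0 < min δ δ' / 2 := half_pos hε0
  have hε4 : 0 < min δ δ' / 4 := by linarith
  set B := (Fintype.card F : ℝ) * (C * C') * Zl (d + 1) (min δ δ' / 2) with hB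
  have hB0 : 0 ≤ B := by rw [hB]; exact mul_nonneg (by positivity) (Zl_nonneg hε)
  set ZK := Zl (d + 1) (min δ δ' / 2 / 2) * latticeConst (d + 1) (min δ δ' / 2 / 2) with hZK
  have hZK0 : 0 ≤ ZK := by rw [hZK]; exact mul_nonneg (Zl_nonneg (half_pos hε)) (latticeConst_nonneg _ (half_pos hε).le)
  -- split the `j`-sum at `j = 0`
  have hsum := summable_tsum_trSh_copies M hX hV hC hC' hδ hδ'
  rw [trace_perF_dper_comp_dper M hX hV hδ hδ', hsum.tsum_eq_add_tsum_ite 0, shiftK_Mmul_zero]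
  -- the `j = 0` copy: PART 4's identity backwards and its wrap-around estimate at the data of `biLoc_copy_zero`
  have hZ0 := biLoc_copy_zero hX hV hC hC' hδ hδ'
  have e0 : ∑' m : Fin (d + 1) → ℤ, trSh M (ExpKernelCalculus.comp X V) m = Matrix.trace (perF M (dper M (ExpKernelCalculus.comp X V))) :=
    (trace_perF_dper M hZ0 hε).symm
  have w0 := abs_trace_perF_dper_sub_tr_le M hZ0 hε hMN
  -- the `j ≠ 0` copies
  obtain ⟨hcs, hcle⟩ := summable_copyConst M hε4 (q - p')
  set E := (Fintype.card F : ℝ) * B * ZK * Real.exp (min δ δ' / 4 * l1 (q - p')) * Real.exp (-(min δ δ' / 4 * N)) with hE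
  have hE0 : 0 ≤ E := by rw [hE]; positivity
  have hg : Summable fun j : Fin (d + 1) → ℤ => E * Real.exp (-(min δ δ' / 4) * l1 (translate M (q - p') j)) := hcs.mul_left E
  have htail := tsum_of_norm_bounded hg.hasSum fun j => by
    rw [Real.norm_eq_abs]
    have := abs_ite_tsum_trSh_copy_le M hX hV hC hC' hδ hδ' hMN j
    rw [hE, hB, hZK]
    exact this
  rw [Real.norm_eq_abs, tsum_mul_left] at htail
  have htail' : |∑' j : Fin (d + 1) → ℤ, (if j = 0 then (0 : ℝ) else
      ∑' m : Fin (d + 1) → ℤ, trSh M (ExpKernelCalculus.comp X (shiftK (fun i => (M i : ℤ) * j i) V)) m)| ≤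
      E * latticeConst (d + 1) (min δ δ' / 4) := htail.trans (mul_le_mul_of_nonneg_left hcle hE0)
  -- assemble
  rw [e0]
  calc |Matrix.trace (perF M (dper M (ExpKernelCalculus.comp X V)))
          + ∑' j : Fin (d + 1) → ℤ, (if j = 0 then (0 : ℝ) else
              ∑' m : Fin (d + 1) → ℤ, trSh M (ExpKernelCalculus.comp X (shiftK (fun i => (M i : ℤ) * j i) V)) m)
          - tr (ExpKernelCalculus.comp X V)|
      = |(Matrix.trace (perF M (dper M (ExpKernelCalculus.comp X V))) - tr (ExpKernelCalculus.comp X V))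
          + ∑' j : Fin (d + 1) → ℤ, (if j = 0 then (0 : ℝ) else
              ∑' m : Fin (d + 1) → ℤ, trSh M (ExpKernelCalculus.comp X (shiftK (fun i => (M i : ℤ) * j i) V)) m)| := by ring_nf
    _ ≤ |Matrix.trace (perF M (dper M (ExpKernelCalculus.comp X V))) - tr (ExpKernelCalculus.comp X V)|
          + |∑' j : Fin (d + 1) → ℤ, (if j = 0 then (0 : ℝ) else
              ∑' m : Fin (d + 1) → ℤ, trSh M (ExpKernelCalculus.comp X (shiftK (fun i => (M i : ℤ) * j i) V)) m)| := abs_add_le _ _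
    _ ≤ (Fintype.card F : ℝ) * (B * Real.exp (-(min δ δ' / 2) * l1 (q - p'))) * Real.exp (min δ δ' / 2 / 2 * l1 (p - q')) * ZK *
            Real.exp (-(min δ δ' / 2 / 2 * N)) + E * latticeConst (d + 1) (min δ δ' / 4) := add_le_add w0 htail'
    _ = _ := by
        rw [hE, hZK, hB]
        have h4 : min δ δ' / 2 / 2 = min δ δ' / 4 := by ring
        rw [h4]
        ring

end Bound

/-! ## §2 The `Tendsto` corollary along growing boxes -/

section Limit

variable {X V : MKer (d + 1) F} {C C' δ δ' : ℝ} {p q p' q' : Fin (d + 1) → ℤ}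

/-- [folklore] **`tendsto_trace_perF_dper_comp_dper`**: along any box sequence `Mk` whose periods eventually exceed every `N`
(`∀ N, ∀ᶠ k, ∀ i, N ≤ Mk k i` — the OWNER's #23 `law_of_tendsto` hypothesis shape), the two-insertion torus read-out converges to the lattice one:
`trace (perF (Mk k) (dper (Mk k) (X ⋆ dper (Mk k) V))) → tr (X ⋆ V)`. -/
theorem tendsto_trace_perF_dper_comp_dper (Mk : ℕ → (Fin (d + 1) → ℕ)) [∀ k μ, NeZero (Mk k μ)]
    (hMk : ∀ N : ℕ, ∀ᶠ k in atTop, ∀ i, N ≤ Mk k i)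
    (hX : BiLoc X p q C δ) (hV : BiLoc V p' q' C' δ') (hδ : 0 < δ) (hδ' : 0 < δ') :
    Tendsto (fun k => Matrix.trace (perF (Mk k) (dper (Mk k) (ExpKernelCalculus.comp X (dper (Mk k) V))))) atTop
      (𝓝 (tr (ExpKernelCalculus.comp X V))) := by
  set K := (Fintype.card F : ℝ) * ((Fintype.card F : ℝ) * (C * C') * Zl (d + 1) (min δ δ' / 2)) *
        (Zl (d + 1) (min δ δ' / 2 / 2) * latticeConst (d + 1) (min δ δ' / 2 / 2)) *
        (Real.exp (-(min δ δ' / 2) * l1 (q - p')) * Real.exp (min δ δ' / 2 / 2 * l1 (p - q'))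
          + Real.exp (min δ δ' / 4 * l1 (q - p')) * latticeConst (d + 1) (min δ δ' / 4)) with hK
  have hε4 : 0 < min δ δ' / 4 := by have := lt_min hδ hδ'; linarith
  -- `K · e^{−(ε/4) N} → 0` as `N → ∞`
  have hlim : Tendsto (fun N : ℕ => K * Real.exp (-(min δ δ' / 4 * N))) atTop (𝓝 0) := by
    have h1 : Tendsto (fun N : ℕ => min δ δ' / 4 * (N : ℝ)) atTop atTop :=
      (tendsto_natCast_atTop_atTop).const_mul_atTop hε4
    have h2 : Tendsto (fun N : ℕ => Real.exp (-(min δ δ' / 4 * N))) atTop (𝓝 0) :=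
      Real.tendsto_exp_neg_atTop_nhds_zero.comp h1
    simpa using h2.const_mul K
  rw [Metric.tendsto_atTop]
  intro e he
  have hev : ∀ᶠ N : ℕ in atTop, K * Real.exp (-(min δ δ' / 4 * N)) < e := by
    have := (Metric.tendsto_atTop.1 hlim) e he
    obtain ⟨N₀, hN₀⟩ := this
    exact eventually_atTop.2 ⟨N₀, fun N hN => by have := hN₀ N hN; rw [Real.dist_eq, sub_zero] at this; exact (le_abs_self _).trans_lt this⟩
  obtain ⟨N, hN⟩ := hev.exists
  obtain ⟨k₀, hk₀⟩ := eventually_atTop.1 (hMk N)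
  refine ⟨k₀, fun k hk => ?_⟩
  rw [Real.dist_eq]
  exact (abs_trace_perF_dper_comp_dper_sub_tr_le (Mk k) hX hV hδ hδ' (hk₀ k hk)).trans_lt hN

end Limit

/-! ## §3 The (T-ID) assembly's words: the TADPOLE `A ⋆ dper W` and the BUBBLE `A ⋆ dper U ⋆ A ⋆ dper V` through an `Mℤ`-invariant decaying leg `A` -/

section Words

variable (M : Fin (d + 1) → ℕ) [∀ μ, NeZero (M μ)]
variable {A U V : MKer (d + 1) F} {CA CU CV α δU δV : ℝ} {p q p' q' : Fin (d + 1) → ℤ}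

/-- [folklore] a decaying leg and a bi-localised insertion at a COMMON rate `γ = min α δU`: `A ⋆ U` is bi-localised at `U`'s points with constant
`|F|·CA·CU·Zl(γ∕2)`, rate `γ∕2` (`biLoc_comp_decays`). -/
theorem biLoc_leg_comp (hA : Decays A CA α) (hU : BiLoc U p q CU δU) (hCA : 0 ≤ CA) (hCU : 0 ≤ CU) (hα : 0 < α) (hδU : 0 < δU) :
    BiLoc (ExpKernelCalculus.comp A U) p q ((Fintype.card F : ℝ) * (CA * CU) * Zl (d + 1) (min α δU - min α δU / 2)) (min α δU / 2) :=
  biLoc_comp_decays (decays_mono hA hCA le_rfl (min_le_left α δU)) (biLoc_mono hU hCU (min_le_right α δU))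
    (half_pos (lt_min hα hδU)).le (half_lt_self (lt_min hα hδU))

/-- [folklore] **THE BUBBLE's LATTICE WORD `X := (A ⋆ U) ⋆ A` IS BI-LOCALISED** at `U`'s points `(p, q)`, rate `γ∕4`, `γ = min α δU`, constant
`|F|·(|F|·CA·CU·Zl(γ∕2)·CA)·Zl(γ∕4)` (`biLoc_comp_right`). -/
theorem biLoc_bubble_word (hA : Decays A CA α) (hU : BiLoc U p q CU δU) (hCA : 0 ≤ CA) (hCU : 0 ≤ CU) (hα : 0 < α) (hδU : 0 < δU) :
    BiLoc (ExpKernelCalculus.comp (ExpKernelCalculus.comp A U) A) p q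
      ((Fintype.card F : ℝ) * (((Fintype.card F : ℝ) * (CA * CU) * Zl (d + 1) (min α δU - min α δU / 2)) * CA) *
        Zl (d + 1) (min α δU / 2 - min α δU / 4)) (min α δU / 4) := by
  have hγ : 0 < min α δU := lt_min hα hδU
  have h1 := biLoc_leg_comp hA hU hCA hCU hα hδU
  have hA2 : Decays A CA (min α δU / 2) := decays_mono hA hCA le_rfl ((half_le_self hγ.le).trans (min_le_left α δU))
  have h := biLoc_comp_right h1 hA2 (show 0 ≤ min α δU / 4 by positivity) (show min α δU / 4 < min α δU / 2 by linarith)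
  exact h

/-- [folklore] **THE TADPOLE READ-OUT**: `perF M A * perF M (dper M W) = perF M (dper M (A ⋆ W))` for an `Mℤ`-invariant decaying leg `A` and a bi-localised
vertex `W` (PART A `perF_comp` + PART 3 `comp_dper_left`). -/
theorem perF_mul_perF_dper (hA : Decays A CA α) (hα : 0 < α)
    (hAinv : ∀ (m x y : Fin (d + 1) → ℤ) (a b : F), A (translate M x m) (translate M y m) a b = A x y a b)
    (hV : BiLoc V p' q' CV δV) (hCV : 0 ≤ CV) (hδV : 0 < δV) :
    perF M A * perF M (dper M V) = perF M (dper M (ExpKernelCalculus.comp A V)) := by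
  rw [← comp_dper_left M hA hα hAinv hV hδV]
  exact (perF_comp M hA (decays_dper M hV hCV hδV) hα (half_pos hδV) (fun m x y a b => dper_translate M V m x y a b)).symm

/-- [folklore] **`abs_trace_tadpole_sub_tr_le` — THE TADPOLE's WRAP-AROUND**: for periods `M_i ≥ N`,
`|trace (perF M A * perF M (dper M W)) − tr (A ⋆ W)| ≤ |F|·C₁·e^{(γ∕4)|p′−q′|₁}·Zl(γ∕4)·K(γ∕4)·e^{−(γ∕4)N}`, `γ = min α δW`, `C₁ = |F|·CA·CW·Zl(γ∕2)`
(PART 4's `abs_trace_perF_dper_sub_tr_le` at the bi-localisation of `A ⋆ W`). -/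
theorem abs_trace_tadpole_sub_tr_le (hA : Decays A CA α) (hα : 0 < α)
    (hAinv : ∀ (m x y : Fin (d + 1) → ℤ) (a b : F), A (translate M x m) (translate M y m) a b = A x y a b)
    (hV : BiLoc V p' q' CV δV) (hδV : 0 < δV) {N : ℕ} (hMN : ∀ i, N ≤ M i) :
    |Matrix.trace (perF M A * perF M (dper M V)) - tr (ExpKernelCalculus.comp A V)| ≤
      (Fintype.card F : ℝ) * ((Fintype.card F : ℝ) * (CA * CV) * Zl (d + 1) (min α δV - min α δV / 2)) *
        Real.exp (min α δV / 2 / 2 * l1 (p' - q')) * (Zl (d + 1) (min α δV / 2 / 2) * latticeConst (d + 1) (min α δV / 2 / 2)) *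
        Real.exp (-(min α δV / 2 / 2 * N)) := by
  rcases isEmpty_or_nonempty F with hF | ⟨⟨a₀⟩⟩
  · have h0 : Matrix.trace (perF M A * perF M (dper M V)) = 0 := by
      rw [Matrix.trace]; simp [Finset.univ_eq_empty]
    have h1 : tr (ExpKernelCalculus.comp A V) = 0 := by
      simp only [ExpKernelCalculus.tr, Finset.univ_eq_empty, Finset.sum_empty, tsum_zero]
    rw [h0, h1, sub_zero, abs_zero, Fintype.card_eq_zero, Nat.cast_zero]
    simp
  have hCA : 0 ≤ CA := hA.nonneg a₀
  have hCV : 0 ≤ CV := hV.nonneg a₀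
  rw [perF_mul_perF_dper M hA hα hAinv hV hCV hδV]
  exact abs_trace_perF_dper_sub_tr_le M (biLoc_leg_comp hA hV hCA hCV hα hδV) (half_pos (lt_min hα hδV)) hMN

/-- [folklore] **THE BUBBLE READ-OUT AS ONE PERIODISED WORD**: `perF M A * perF M (dper M U) * perF M A * perF M (dper M V) =
perF M (dper M (((A ⋆ U) ⋆ A) ⋆ dper M V))` — PART A's `perF_comp` three times and PART 3's `comp_dper_left ∕ comp_dper_right` (the leg is invariant,
the insertions localised; no reassociation of lattice words needed). -/
theorem perF_bubble_word (hA : Decays A CA α) (hα : 0 < α)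
    (hAinv : ∀ (m x y : Fin (d + 1) → ℤ) (a b : F), A (translate M x m) (translate M y m) a b = A x y a b)
    (hU : BiLoc U p q CU δU) (hCU : 0 ≤ CU) (hδU : 0 < δU) (hV : BiLoc V p' q' CV δV) (hCV : 0 ≤ CV) (hδV : 0 < δV) (hCA : 0 ≤ CA) :
    perF M A * perF M (dper M U) * perF M A * perF M (dper M V) =
      perF M (dper M (ExpKernelCalculus.comp (ExpKernelCalculus.comp (ExpKernelCalculus.comp A U) A) (dper M V))) := by
  have hγ : 0 < min α δU := lt_min hα hδU
  have hinvU : ∀ (m x y : Fin (d + 1) → ℤ) (a b : F), dper M U (translate M x m) (translate M y m) a b = dper M U x y a b :=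
    fun m x y a b => dper_translate M U m x y a b
  have hinvV : ∀ (m x y : Fin (d + 1) → ℤ) (a b : F), dper M V (translate M x m) (translate M y m) a b = dper M V x y a b :=
    fun m x y a b => dper_translate M V m x y a b
  -- the lattice words and their localisation ∕ decay data
  have hAU := biLoc_leg_comp hA hU hCA hCU hα hδU
  have hX := biLoc_bubble_word hA hU hCA hCU hα hδU
  have hCAU : 0 ≤ (Fintype.card F : ℝ) * (CA * CU) * Zl (d + 1) (min α δU - min α δU / 2) :=
    mul_nonneg (by positivity) (Zl_nonneg (by linarith))
  have hCX : 0 ≤ (Fintype.card F : ℝ) * (((Fintype.card F : ℝ) * (CA * CU) * Zl (d + 1) (min α δU - min α δU / 2)) * CA) *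
      Zl (d + 1) (min α δU / 2 - min α δU / 4) := mul_nonneg (by positivity) (Zl_nonneg (by linarith))
  have hA2 : Decays A CA (min α δU / 2) := decays_mono hA hCA le_rfl ((half_le_self hγ.le).trans (min_le_left α δU))
  -- step 1: `A ⋆ dper U = dper (A ⋆ U)`;  step 2: `dper (A ⋆ U) ⋆ A = dper X`;  step 3: `dper X ⋆ dper V = dper (X ⋆ dper V)`
  have s1 : ExpKernelCalculus.comp A (dper M U) = dper M (ExpKernelCalculus.comp A U) := comp_dper_left M hA hα hAinv hU hδU
  have s2 : ExpKernelCalculus.comp (dper M (ExpKernelCalculus.comp A U)) A = dper M (ExpKernelCalculus.comp (ExpKernelCalculus.comp A U) A) :=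
    comp_dper_right M hAU (half_pos hγ) hA2 (half_pos hγ) hAinv
  have s3 : ExpKernelCalculus.comp (dper M (ExpKernelCalculus.comp (ExpKernelCalculus.comp A U) A)) (dper M V) =
      dper M (ExpKernelCalculus.comp (ExpKernelCalculus.comp (ExpKernelCalculus.comp A U) A) (dper M V)) :=
    comp_dper_right M hX (by positivity) (decays_dper M hV hCV hδV) (half_pos hδV) hinvV
  -- the three `perF` products
  have e1 : perF M (ExpKernelCalculus.comp A (dper M U)) = perF M A * perF M (dper M U) :=
    perF_comp M hA (decays_dper M hU hCU hδU) hα (half_pos hδU) hinvU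
  have e2 : perF M (ExpKernelCalculus.comp (dper M (ExpKernelCalculus.comp A U)) A) = perF M (dper M (ExpKernelCalculus.comp A U)) * perF M A :=
    perF_comp M (decays_dper M hAU hCAU (half_pos hγ)) hA (half_pos (half_pos hγ)) hα hAinv
  have e3 : perF M (ExpKernelCalculus.comp (dper M (ExpKernelCalculus.comp (ExpKernelCalculus.comp A U) A)) (dper M V)) =
      perF M (dper M (ExpKernelCalculus.comp (ExpKernelCalculus.comp A U) A)) * perF M (dper M V) :=
    perF_comp M (decays_dper M hX hCX (by positivity)) (decays_dper M hV hCV hδV) (by positivity) (half_pos hδV) hinvV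
  rw [← e1, s1, ← e2, s2, ← e3, s3]

/-- [folklore] **`trace_bubble_eq_tsum` — THE BUBBLE READ-OUT IS THE DOUBLE PERIOD SUM** (P2″ (i) for the assembly's word):
`trace (perF A · perF (dper U) · perF A · perF (dper V)) = Σ'_j Σ'_m trSh M (((A ⋆ U) ⋆ A) ⋆ shiftK (M∘j) V) m`. -/
theorem trace_bubble_eq_tsum (hA : Decays A CA α) (hα : 0 < α)
    (hAinv : ∀ (m x y : Fin (d + 1) → ℤ) (a b : F), A (translate M x m) (translate M y m) a b = A x y a b)
    (hU : BiLoc U p q CU δU) (hδU : 0 < δU) (hV : BiLoc V p' q' CV δV) (hδV : 0 < δV) :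
    Matrix.trace (perF M A * perF M (dper M U) * perF M A * perF M (dper M V)) =
      ∑' j : Fin (d + 1) → ℤ, ∑' m : Fin (d + 1) → ℤ,
        trSh M (ExpKernelCalculus.comp (ExpKernelCalculus.comp (ExpKernelCalculus.comp A U) A) (shiftK (fun i => (M i : ℤ) * j i) V)) m := by
  rcases isEmpty_or_nonempty F with hF | ⟨⟨a₀⟩⟩
  · rw [Matrix.trace]; simp [Finset.univ_eq_empty, KernelPeriodisationFibTrace.trSh_apply, tsum_zero]
  have hCA : 0 ≤ CA := hA.nonneg a₀
  have hCU : 0 ≤ CU := hU.nonneg a₀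
  have hCV : 0 ≤ CV := hV.nonneg a₀
  rw [perF_bubble_word M hA hα hAinv hU hCU hδU hV hCV hδV hCA]
  exact trace_perF_dper_comp_dper M (biLoc_bubble_word hA hU hCA hCU hα hδU) hV (by have := lt_min hα hδU; positivity) hδV

/-- [folklore] **`abs_trace_bubble_sub_tr_le` — THE BUBBLE's WRAP-AROUND (P2″ (ii))**: for periods `M_i ≥ N`,
`|trace (perF A · perF (dper U) · perF A · perF (dper V)) − tr (((A ⋆ U) ⋆ A) ⋆ V)| ≤ C″ · e^{−(ε∕4)N}` with `ε = min (γ∕4) δV`, `γ = min α δU`,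
and `C″` = the constant of `abs_trace_perF_dper_comp_dper_sub_tr_le` at the bi-localisation data of `X := (A ⋆ U) ⋆ A` (displayed). -/
theorem abs_trace_bubble_sub_tr_le (hA : Decays A CA α) (hα : 0 < α)
    (hAinv : ∀ (m x y : Fin (d + 1) → ℤ) (a b : F), A (translate M x m) (translate M y m) a b = A x y a b)
    (hU : BiLoc U p q CU δU) (hδU : 0 < δU) (hV : BiLoc V p' q' CV δV) (hδV : 0 < δV) {N : ℕ} (hMN : ∀ i, N ≤ M i) :
    |Matrix.trace (perF M A * perF M (dper M U) * perF M A * perF M (dper M V))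
        - tr (ExpKernelCalculus.comp (ExpKernelCalculus.comp (ExpKernelCalculus.comp A U) A) V)| ≤
      (Fintype.card F : ℝ) * ((Fintype.card F : ℝ) *
          ((Fintype.card F : ℝ) * (((Fintype.card F : ℝ) * (CA * CU) * Zl (d + 1) (min α δU - min α δU / 2)) * CA) *
            Zl (d + 1) (min α δU / 2 - min α δU / 4) * CV) * Zl (d + 1) (min (min α δU / 4) δV / 2)) *
        (Zl (d + 1) (min (min α δU / 4) δV / 2 / 2) * latticeConst (d + 1) (min (min α δU / 4) δV / 2 / 2)) *
        (Real.exp (-(min (min α δU / 4) δV / 2) * l1 (q - p')) * Real.exp (min (min α δU / 4) δV / 2 / 2 * l1 (p - q'))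
          + Real.exp (min (min α δU / 4) δV / 4 * l1 (q - p')) * latticeConst (d + 1) (min (min α δU / 4) δV / 4)) *
        Real.exp (-(min (min α δU / 4) δV / 4 * N)) := by
  rcases isEmpty_or_nonempty F with hF | ⟨⟨a₀⟩⟩
  · have h0 : Matrix.trace (perF M A * perF M (dper M U) * perF M A * perF M (dper M V)) = 0 := by
      rw [Matrix.trace]; simp [Finset.univ_eq_empty]
    have h1 : tr (ExpKernelCalculus.comp (ExpKernelCalculus.comp (ExpKernelCalculus.comp A U) A) V) = 0 := by
      simp only [ExpKernelCalculus.tr, Finset.univ_eq_empty, Finset.sum_empty, tsum_zero]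
    rw [h0, h1, sub_zero, abs_zero, Fintype.card_eq_zero, Nat.cast_zero]
    simp
  have hCA : 0 ≤ CA := hA.nonneg a₀
  have hCU : 0 ≤ CU := hU.nonneg a₀
  have hCV : 0 ≤ CV := hV.nonneg a₀
  rw [perF_bubble_word M hA hα hAinv hU hCU hδU hV hCV hδV hCA]
  exact abs_trace_perF_dper_comp_dper_sub_tr_le M (biLoc_bubble_word hA hU hCA hCU hα hδU) hV (by have := lt_min hα hδU; positivity) hδV hMN

/-- [folklore] **`tendsto_trace_bubble` — the bubble read-out along growing boxes converges to the lattice bubble.** -/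
theorem tendsto_trace_bubble (Mk : ℕ → (Fin (d + 1) → ℕ)) [∀ k μ, NeZero (Mk k μ)] (hMk : ∀ N : ℕ, ∀ᶠ k in atTop, ∀ i, N ≤ Mk k i)
    (hA : Decays A CA α) (hα : 0 < α)
    (hAinv : ∀ k (m x y : Fin (d + 1) → ℤ) (a b : F), A (translate (Mk k) x m) (translate (Mk k) y m) a b = A x y a b)
    (hU : BiLoc U p q CU δU) (hδU : 0 < δU) (hV : BiLoc V p' q' CV δV) (hδV : 0 < δV) :
    Tendsto (fun k => Matrix.trace (perF (Mk k) A * perF (Mk k) (dper (Mk k) U) * perF (Mk k) A * perF (Mk k) (dper (Mk k) V))) atTop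
      (𝓝 (tr (ExpKernelCalculus.comp (ExpKernelCalculus.comp (ExpKernelCalculus.comp A U) A) V))) := by
  rcases isEmpty_or_nonempty F with hF | ⟨⟨a₀⟩⟩
  · have h0 : ∀ k, Matrix.trace (perF (Mk k) A * perF (Mk k) (dper (Mk k) U) * perF (Mk k) A * perF (Mk k) (dper (Mk k) V)) = 0 := fun k => by
      rw [Matrix.trace]; simp [Finset.univ_eq_empty]
    have h1 : tr (ExpKernelCalculus.comp (ExpKernelCalculus.comp (ExpKernelCalculus.comp A U) A) V) = 0 := by
      simp only [ExpKernelCalculus.tr, Finset.univ_eq_empty, Finset.sum_empty, tsum_zero]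
    simp only [h0, h1]
    exact tendsto_const_nhds
  have hCA : 0 ≤ CA := hA.nonneg a₀
  have hCU : 0 ≤ CU := hU.nonneg a₀
  have hCV : 0 ≤ CV := hV.nonneg a₀
  have h := tendsto_trace_perF_dper_comp_dper Mk hMk (biLoc_bubble_word hA hU hCA hCU hα hδU) hV (by have := lt_min hα hδU; positivity) hδV
  refine h.congr fun k => ?_
  rw [perF_bubble_word (Mk k) hA hα (hAinv k) hU hCU hδU hV hCV hδV hCA]

end Words

end Summit.QuantumFields.BalabanUV.Beta.FP.KernelPeriodisationFibTraceTwoBound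

end
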